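import Mathlib
import Literature.MathematicalPhysics.QuantumFieldTheory.Balaban1983to89.B2StepK
import Literature.MathematicalPhysics.QuantumFieldTheory.Balaban1983to89.B2Sect2Statements

/-!
# `Balaban1983to89.B2StepKSect2Bridge` — B2 §2.B–§2.D pp. 566–582 [Balaban1982Higgs2]: the dictionaries between the
# two independent typings of Propositions 2.1, 2.6, Lemmas 2.3, 2.5, 2.7, (2.116), (2.117) — unit r14's `…B2StepK`
# and unit r02's `…B2Sect2Statements` (decls of record) — and the bookkeeping bridges between them

statement-level skeleton of published theorems with citation tags; proofs where landed; nothing here is a claim about the Yang–Mills mass gap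

B2 = T. Bałaban, *(Higgs)₂,₃ quantum fields in a finite volume. II. An upper bound*, Commun. Math. Phys. **86**,
555–594 (1982) [Balaban1982Higgs2] (held: `paper:balaban1982-cmp86-higgs23-ii`; journal page = PDF page + 554).
Unit `lit-balaban-r14` gen 2 (READER/TYPER of B1–B2), v1 2026-08-21; answers referee ref-2's I2 ask (gens 4–6:
*"B2StepK ↔ B2Sect2Statements: one cross-naming docstring sentence + the bridge lemma"*).

WHY TWO TYPINGS EXIST.  The nine §2 statements (2.43), Prop. 2.1 (2.57), Prop. 2.2 (2.58), Lemma 2.3 (2.59)–(2.60),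
Lemma 2.5 (2.81), Prop. 2.6, Lemma 2.7 (2.113), (2.116), (2.117) were typed twice on 2026-08-20, blind of each
other: `…B2Sect2Statements` (r02, p239259, landed first) and `…B2StepK` (r14, p239461).  DECLS OF RECORD for the
SKELETON rows B2.Eq2.43, B2.Prop2.1, B2.Lem2.3, B2.Lem2.5, B2.Prop2.6, B2.Lem2.7, B2.Eq2.116, B2.Eq2.117 are r02's
`B2Sect2Statements.{Ineq243Printed, Prop21Printed, Lemma23Printed, Lemma25Printed, Prop26Printed, Lemma27Printed,
Ineq2116, Claim2117Printed}`; for B2.Prop2.2 it is r14's `B2StepK.Prop22Printed` (clause dist(·, Ωᶜ) typed as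
printed; r02 ruling 2026-08-20T23:06Z and `B2Sect2Statements` v1.2 erratum).  The twins differ only in CARRIER SHAPE:
r02 indexes ONE instance (one step of one run) and exposes suprema (`dev259a`, `dev281a`, `dev2113`, …); r14 indexes
RUNS with the step `k : ℕ` inside and exposes the pointwise quantities.  Both modules are append-only in the tree
(other seats import them), so neither twin is pruned; this module records the relation in Lean.

WHAT IS HERE (bookkeeping only — no mathematics of the paper is involved; every proof is a few lines of quantifier
shuffling).  Dictionaries `run2117OfFinalRun` ((2.117): `FinalRun` ↦ `Run2117`), `p26OfSect2` (Prop. 2.6),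
`p21OfSect2` (Prop. 2.1 / (2.116)); bridges `ineq2117Printed_iff_claim2117Printed` ((2.117): the two typings are
definitionally the same statement), `prop26Printed_of_sect2` / `sect2_of_prop26Printed` (Prop. 2.6, both directions),
`prop21Printed_of_sect2` (Prop. 2.1), `ineq2116Printed_of_sect2` ((2.116)), `lemma23Printed_of_sect2` (Lemma 2.3),
`lemma25Printed_of_sect2` (Lemma 2.5), `lemma27Printed_of_sect2` / `sect2_of_lemma27Printed` (Lemma 2.7; the converse
when r02's supremum is attained — finite volume).  NO bridge is stated for (2.43) (r02's `Run243.integrand C₇` and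
r14's `Run243.rhs k c c′` expose different data of the same display) nor for Prop. 2.2 (r02's kernels `kGQ`/`kdGQ` are
bond-indexed "at the bond's base point", r14's are site-indexed) — those pairs stay documented twins
(`lit-balaban-r14/ROWS-B2.md` §DUPLICATES D1, D3).
-/

namespace Literature.MathematicalPhysics.QuantumFieldTheory.Balaban1983to89.B2StepKSect2Bridge

open B2StepK

/-- Dictionary for (2.117): r02's one-instance carrier `B2Sect2Statements.FinalRun` (|T_ε| as a site count) read as
this module's `Run2117` at spacing `eps`. [cite: Balaban1982Higgs2, (2.117) p.582] -/
def run2117OfFinalRun (eps : ℝ) (X : B2Sect2Statements.FinalRun) : Run2117 :=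
  { eps := eps, volT := (X.volT : ℝ), lhs := X.lhs }

/-- (2.117): the two typings coincide — `Ineq2117Printed` over the dictionary family IS r02's `Claim2117Printed`
(∀ left constant ∃ right constant ∀ instances). [cite: Balaban1982Higgs2, (2.117) p.582] -/
theorem ineq2117Printed_iff_claim2117Printed {I : Type} (eps : I → ℝ) (fam : I → B2Sect2Statements.FinalRun) :
    Ineq2117Printed (fun i => run2117OfFinalRun (eps i) (fam i)) ↔ B2Sect2Statements.Claim2117Printed fam :=
  Iff.rfl

/-- Dictionary for Prop. 2.6: a family of r02's one-step instances `B2Sect2Statements.P26Setting`, indexed by (run,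
step), read as this module's run-indexed carrier (`ell k` = `scale`, `vol7 k` = `vol7` as a real number).
[cite: Balaban1982Higgs2, Prop. 2.6 p.580] -/
def p26OfSect2 (d : ℕ) {J : Type} (fam : J → ℕ → B2Sect2Statements.P26Setting) (j : J) : P26Setting :=
  { d := d, diffTerms := fun k => (fam j k).diffTerms, vol7 := fun k => ((fam j k).vol7 : ℝ),
    ell := fun k => (fam j k).scale }

/-- Prop. 2.6, r02's typing ⇒ this module's: `B2Sect2Statements.Prop26Printed κ` with d < κ, over instances whose
standing context holds, gives `Prop26Printed` of the dictionary family. [cite: Balaban1982Higgs2, Prop. 2.6 p.580] -/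
theorem prop26Printed_of_sect2 {κ : ℝ} {d : ℕ} (hκ : (d : ℝ) < κ) {J : Type}
    (fam : J → ℕ → B2Sect2Statements.P26Setting) (hctx : ∀ j k, (fam j k).ctx)
    (h : B2Sect2Statements.Prop26Printed κ (fun jk : J × ℕ => fam jk.1 jk.2)) :
    Prop26Printed (p26OfSect2 d fam) := by
  obtain ⟨C, hC⟩ := h
  exact ⟨κ, C, fun _ => hκ, fun j k => hC (j, k) (hctx j k)⟩

/-- Prop. 2.6, this module's typing ⇒ r02's: `Prop26Printed` of the dictionary family (non-empty family of runs)
gives some κ > d with `B2Sect2Statements.Prop26Printed κ` (the context hypothesis is not needed in this direction).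
[cite: Balaban1982Higgs2, Prop. 2.6 p.580] -/
theorem sect2_of_prop26Printed {d : ℕ} {J : Type} [Nonempty J] (fam : J → ℕ → B2Sect2Statements.P26Setting)
    (h : Prop26Printed (p26OfSect2 d fam)) :
    ∃ κ : ℝ, (d : ℝ) < κ ∧ B2Sect2Statements.Prop26Printed κ (fun jk : J × ℕ => fam jk.1 jk.2) := by
  obtain ⟨κ, C, hκ, hC⟩ := h
  exact ⟨κ, hκ (Classical.arbitrary J), C, fun jk _ => hC jk.1 jk.2⟩

/-- Dictionary for Prop. 2.1 / (2.116): a family of r02's one-step instances `B2Sect2Statements.P21Setting`, indexed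
by (run, step), read as this module's run-indexed carrier; the final step `K j` and the volumes |Λ₇^{(k)}| (`vol7`,
not a field of r02's carrier — they enter r02's `Ineq2116` as arguments) are supplied.
[cite: Balaban1982Higgs2, Prop. 2.1 (2.57) p.570, (2.116) p.582] -/
def p21OfSect2 {J : Type} (K : J → ℕ) (vol7 : J → ℕ → ℝ)
    (fam : J → ℕ → B2Sect2Statements.P21Setting) (j : J) : P21Setting :=
  { K := K j, P := fun k => (fam j k).pFull, Ploc := fun k => (fam j k).pIn, quart := fun k => (fam j k).quartic,
    volDiff := fun k => ((fam j k).vol : ℝ), vol7 := vol7 j, ell := fun k => (fam j k).scale,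
    restr := fun k => (fam j k).restr255 }

/-- Prop. 2.1, r02's typing ⇒ this module's: `B2Sect2Statements.Prop21Printed P` (exponent `P.κ₀ > 0`) gives
`Prop21Printed` of the dictionary family (which quantifies ∃ κ₀ > 0). [cite: Balaban1982Higgs2, Prop. 2.1 (2.57) p.570] -/
theorem prop21Printed_of_sect2 (P : B2.Params) (hκ : 0 < P.κ₀) {J : Type} (K : J → ℕ) (vol7 : J → ℕ → ℝ)
    (fam : J → ℕ → B2Sect2Statements.P21Setting)
    (h : B2Sect2Statements.Prop21Printed P (fun jk : J × ℕ => fam jk.1 jk.2)) :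
    Prop21Printed (p21OfSect2 K vol7 fam) := by
  obtain ⟨C, hC⟩ := h
  exact ⟨P.κ₀, C, hκ, fun j k hr => hC (j, k) hr⟩

/-- (2.116), r02's typing ⇒ this module's: `B2Sect2Statements.Ineq2116 P` at the final steps (scale L^{K}ε, left side
𝒫^{(K)}, volume |Λ₇^{(K)}| as a site count, standing context holding) gives `Ineq2116Printed` of the dictionary
family. [cite: Balaban1982Higgs2, (2.116) p.582] -/
theorem ineq2116Printed_of_sect2 (P : B2.Params) (hκ : 0 < P.κ₀) {J : Type} (K : J → ℕ) (vol7 : J → ℕ → ℝ)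
    (fam : J → ℕ → B2Sect2Statements.P21Setting) (vol7K : J → ℕ) (hvol : ∀ j, vol7 j (K j) = vol7K j)
    (ctx : J → Prop) (hctx : ∀ j, ctx j)
    (h : B2Sect2Statements.Ineq2116 P (fun j => (fam j (K j)).scale) (fun j => (fam j (K j)).pFull) vol7K ctx) :
    Ineq2116Printed (p21OfSect2 K vol7 fam) := by
  obtain ⟨C, hC⟩ := h
  refine ⟨P.κ₀, C, hκ, fun j => ?_⟩
  show (fam j (K j)).pFull ≤ C * (fam j (K j)).scale ^ P.κ₀ * vol7 j (K j)
  rw [hvol]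
  exact hC j (hctx j)

/-- Lemma 2.3, r02's typing (suprema `dev259a`, `dev259b`, `dev260` under (2.55)) ⇒ this module's (pointwise, under
(2.55)): for twin families with the same p(L^kε), compatible restriction clauses, and r02's suprema dominating this
module's pointwise quantities on B^k(Λ₂^{(k−1)}′). [cite: Balaban1982Higgs2, Lemma 2.3 (2.59)–(2.60) p.571] -/
theorem lemma23Printed_of_sect2 {I : Type} (fam : I → L23Setting) (fam' : I → B2Sect2Statements.L23Setting)
    (hp : ∀ i, (fam' i).p = (fam i).p) (hr : ∀ i, (fam i).restr → (fam' i).restr255)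
    (ha : ∀ i x, (fam i).inL2 ((fam i).blk x) → |(fam i).Ak x - (fam i).A ((fam i).blk x)| ≤ (fam' i).dev259a)
    (hb : ∀ i x, (fam i).inL2 ((fam i).blk x) → |(fam i).Ak x - (fam i).QsA x| ≤ (fam' i).dev259b)
    (hc : ∀ i μ x, (fam i).inL2 ((fam i).blk x) → (fam i).dAk μ x ≤ (fam' i).dev260)
    (h : B2Sect2Statements.Lemma23Printed fam') : Lemma23Printed fam := by
  obtain ⟨C, hC⟩ := h
  refine ⟨C, fun i hri => ?_⟩
  obtain ⟨h1, h2, h3⟩ := hC i (hr i hri)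
  rw [hp i] at h1 h2 h3
  exact ⟨fun x hx => ⟨(ha i x hx).trans h1, (hb i x hx).trans h2⟩, fun μ x hx => (hc i μ x hx).trans h3⟩

/-- Lemma 2.5, r02's typing (suprema `dev281a`, `dev281b` under the restrictions on B) ⇒ this module's (pointwise):
same dictionary conditions as for Lemma 2.3. [cite: Balaban1982Higgs2, Lemma 2.5 (2.81) p.574] -/
theorem lemma25Printed_of_sect2 {I : Type} (fam : I → L25Setting) (fam' : I → B2Sect2Statements.L25Setting)
    (hp : ∀ i, (fam' i).p = (fam i).p) (hr : ∀ i, (fam i).restr → (fam' i).restrB)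
    (ha : ∀ i x, (fam i).inL1 ((fam i).blk x) → |(fam i).CQsB x - (fam i).B ((fam i).blk x)| ≤ (fam' i).dev281a)
    (hb : ∀ i x, (fam i).inL1 ((fam i).blk x) → |(fam i).CQsB x - (fam i).QsB x| ≤ (fam' i).dev281b)
    (h : B2Sect2Statements.Lemma25Printed fam') : Lemma25Printed fam := by
  obtain ⟨C, hC⟩ := h
  refine ⟨C, fun i hri x hx => ?_⟩
  obtain ⟨h1, h2⟩ := hC i (hr i hri)
  rw [hp i] at h1 h2
  exact ⟨(ha i x hx).trans h1, (hb i x hx).trans h2⟩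

/-- Lemma 2.7, r02's typing (supremum `dev2113` over Λ₅^{(k)} under the restrictions on ψ) ⇒ this module's
(pointwise on Λ₅^{(k)}). [cite: Balaban1982Higgs2, Lemma 2.7 (2.113) p.581] -/
theorem lemma27Printed_of_sect2 {I : Type} (fam : I → L27Setting) (fam' : I → B2Sect2Statements.L27Setting)
    (hp : ∀ i, (fam' i).p = (fam i).p) (hr : ∀ i, (fam i).restr → (fam' i).restrψ)
    (hd : ∀ i x, (fam i).inL5 x → |(fam i).CQsψ x - (fam i).Qsψ x| ≤ (fam' i).dev2113)
    (h : B2Sect2Statements.Lemma27Printed fam') : Lemma27Printed fam := by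
  obtain ⟨C, hC⟩ := h
  refine ⟨C, fun i hri x hx => ?_⟩
  have h1 := hC i (hr i hri)
  rw [hp i] at h1
  exact (hd i x hx).trans h1

/-- Lemma 2.7, this module's typing ⇒ r02's, when r02's supremum is ATTAINED at a point of Λ₅^{(k)} (finite volume)
and the restriction clauses are compatible the other way. [cite: Balaban1982Higgs2, Lemma 2.7 (2.113) p.581] -/
theorem sect2_of_lemma27Printed {I : Type} (fam : I → L27Setting) (fam' : I → B2Sect2Statements.L27Setting)
    (hp : ∀ i, (fam' i).p = (fam i).p) (hr : ∀ i, (fam' i).restrψ → (fam i).restr)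
    (hatt : ∀ i, (fam' i).restrψ → ∃ x, (fam i).inL5 x ∧ (fam' i).dev2113 = |(fam i).CQsψ x - (fam i).Qsψ x|)
    (h : Lemma27Printed fam) : B2Sect2Statements.Lemma27Printed fam' := by
  obtain ⟨C, hC⟩ := h
  refine ⟨C, fun i hri => ?_⟩
  obtain ⟨x, hx, hdev⟩ := hatt i hri
  rw [hdev, hp i]
  exact hC i (hr i hri) x hx

end Literature.MathematicalPhysics.QuantumFieldTheory.Balaban1983to89.B2StepKSect2Bridge
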